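import Mathlib
import HarnessLib
import Summits.NavierStokesRegularity.NavierStokesRegularity.Theorems.PoloidalWindowDoorPoloidalWindowRigiditySymmetryGerms
import Summits.NavierStokesRegularity.NavierStokesRegularity.Theorems.PoloidalWindowDoorPoloidalWindowRigidityTimeHeightShearNormalForm
import Summits.NavierStokesRegularity.NavierStokesRegularity.Theorems.PoloidalWindowDoorPoloidalWindowRigidityClebsch
import Summits.NavierStokesRegularity.NavierStokesRegularity.Theorems.PoloidalWindowDoorLrcModEntireTwistingTHOscLiouville
import Summits.NavierStokesRegularity.NavierStokesRegularity.Theorems.PoloidalWindowDoorLrcModEntireTwistingTHPlaneOscillationLink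
import Summits.NavierStokesRegularity.NavierStokesRegularity.Theorems.PoloidalWindowDoorLrcModEntireTwistingTHOscSimilarityObject
import Summits.NavierStokesRegularity.NavierStokesRegularity.Theorems.PoloidalWindowDoorLrcModEntireTwistingTHOscRoadMajorant

/-!
# Item `LrcModEntire` (stmt-NavierStokesRegularity-20428), skeleton twist_split v6 — the CLASS road to `stub_twistingTHGerm` BY NAME in PHYSICAL (t,z) CURRENCY:
# `stub_twistingTHGerm` ⇐ «∃ (O, Od, S) on t < 0: (OSC) pointwise, the Type-I dictionary of bounds (incl. √(−t)·O ≤ c), regularity, and the plane majorant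
# |(1−μ)(v₂(t,y) − v₂(t,y′))| ≤ O(t,z) on proportional-shear planes» — no similarity variables visible

Cell ns-regularity-ideate, LEAD ns-poloidal-K2-p3 g13 (`--supports stmt-NavierStokesRegularity-20428`; the last assembly of the division of labour with ns-k2-port-2 g3:
their (h2-b) `…TwistingTHOscSimilarityObject.simObject_of_planeObject` (p688xxx) turns the (t,z)-object into the similarity object, `…TwistingTHOscLiouville._anyK`
(explicit weight ∘ duality) kills it, `exists_sim_preimage` brings `Q ≡ 0` back to `O ≡ 0`, and the ending of `…TwistingTHOscRoadMajorant` (link lemma + normal form +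
flat planes + openness of non-flatness) gives `v ≡ 0`).

* `eq_zero_of_weightOsc_zero` — class + poloidal + a (TH) window + «on every proportional-shear plane of the slice t = −1 the weight oscillation vanishes» ⇒ `v ≡ 0`
  (the ending, factored out);
* `eq_zero_of_planeOscObject` — class + poloidal + (TH) window + the (t,z)-object ⇒ `v ≡ 0`;
* `twistingTHGerm_of_planeOscObject` — the registered signature of `stub_twistingTHGerm` VERBATIM from the (t,z)-object supplied per normalised windowed profile.
READING: the (TH) column of `LrcModEntire` = produce, for the weighted plane oscillation of v₂, a C²-in-z / jointly-C¹ majorant O with (OSC) and the Type-I dictionary —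
(h1) the size bound √(−t)·O ≤ c toward the past [WALL] + (h2) smoothness (soft envelopes, memo §5sexies).  The INPUT list is port-2's, verbatim.

WHAT THIS IS NOT: not a claim about Navier–Stokes regularity and not a proof of the stub — a reduction BY NAME to a typed analytic hypothesis in physical variables
(bears_on LADDER-NS N0, item 20428 / crux 19708; both OPEN).
-/

noncomputable section

-- the summit and its single sub-problem share the name (CONVENTIONS §1), as in every Theorems file
set_option linter.dupNamespace false

namespace Summit.NavierStokesRegularity.NavierStokesRegularity.Theorems.PoloidalWindowDoorLrcModEntireTwistingTHOscRoadPlane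

open Set Filter Topology Function
open scoped RealInnerProductSpace InnerProductSpace Laplacian
open Literature.Analysis Literature.Analysis.FluidPDE
open Summit.NavierStokesRegularity.NavierStokesRegularity.Theorems.PoloidalWindowDoorPoloidalWindowRigiditySymmetryGerms
open Summit.NavierStokesRegularity.NavierStokesRegularity.Theorems.PoloidalWindowDoorPoloidalWindowRigidityTimeHeightShearNormalForm
open Summit.NavierStokesRegularity.NavierStokesRegularity.Theorems.PoloidalWindowDoorPoloidalWindowRigidityClebsch
open Summit.NavierStokesRegularity.NavierStokesRegularity.Theorems.PoloidalWindowDoorLrcModEntireTwistingTHOscLiouville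
open Summit.NavierStokesRegularity.NavierStokesRegularity.Theorems.PoloidalWindowDoorLrcModEntireTwistingTHPlaneOscillationLink
open Summit.NavierStokesRegularity.NavierStokesRegularity.Theorems.PoloidalWindowDoorLrcModEntireTwistingTHOscSimilarityDefs
open Summit.NavierStokesRegularity.NavierStokesRegularity.Theorems.PoloidalWindowDoorLrcModEntireTwistingTHOscSimilarityTransform
open Summit.NavierStokesRegularity.NavierStokesRegularity.Theorems.PoloidalWindowDoorLrcModEntireTwistingTHOscSimilarityObject
open Summit.NavierStokesRegularity.NavierStokesRegularity.Theorems.PoloidalWindowDoorLrcModEntireTwistingTHOscRoadMajorant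


/-- **THE ENDING, factored out**: class + poloidal + a (TH) window + «on every proportional-shear plane `{y₂ = z}` (slope `μ`) of the slice `t = −1`,
`(1−μ)(v₂(y) − v₂(y′)) = 0` for all `y, y′` on the plane» ⇒ `v ≡ 0`.  (Link lemma ⇒ the vorticity vanishes on every such plane; every plane is flat or
proportional-shear by `timeHeightShear_normalForm`; flat planes on all heights ⇒ `eq_zero_of_flatPlanes_open`; else non-flatness is open in the height and
`eq_zero_of_curl_eq_zero_on_open` ends.) -/
theorem eq_zero_of_weightOsc_zero {C : ℝ} {v : ℝ → EuclideanSpace ℝ (Fin 3) → EuclideanSpace ℝ (Fin 3)}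
    (hrate : HasTypeITimeDecay C v) (hcont : ContinuousOn (uncurry v) (Iio (0 : ℝ) ×ˢ univ))
    (hmild : ∀ s t : ℝ, s < t → t < 0 → ∀ x,
      v t x = UnboundedOperators.heatExtension (v s) (t - s) x - oseenDuhamel 1 s v v t x)
    (hdiv : ∀ t < 0, VectorCalculus.IsDivFree (v t))
    (hpol : ∀ s < 0, ∀ y, ⟪curl (v s) y, EuclideanSpace.single 2 1⟫_ℝ = 0)
    {W : Set (ℝ × EuclideanSpace ℝ (Fin 3))} (hW : IsOpen W) (hWne : W.Nonempty) (hWs : W ⊆ Iio (0 : ℝ) ×ˢ univ)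
    {m : ℝ → ℝ → ℝ}
    (hTH : ∀ z ∈ W, ∀ b : Fin 3, b ≠ 2 →
      fderiv ℝ (v z.1) z.2 (EuclideanSpace.single 2 1) b = m z.1 (z.2 2) * fderiv ℝ (v z.1) z.2 (EuclideanSpace.single b 1) 2)
    (hosc : ∀ z μ : ℝ, (∀ y : EuclideanSpace ℝ (Fin 3), y 2 = z → ∀ b : Fin 3, b ≠ 2 →
        fderiv ℝ (v (-1)) y (EuclideanSpace.single 2 1) b = μ * fderiv ℝ (v (-1)) y (EuclideanSpace.single b 1) 2) →
      ∀ y y' : EuclideanSpace ℝ (Fin 3), y 2 = z → y' 2 = z → (1 - μ) * (v (-1) y 2 - v (-1) y' 2) = 0) :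
    ∀ t < 0, ∀ x, v t x = 0 := by
  have hs : (-1 : ℝ) < 0 := by norm_num
  have hV1 : ContDiff ℝ 1 (v (-1)) := (contDiff_slice hrate hcont hmild hs).of_le (by norm_cast)
  have hVd : Differentiable ℝ (v (-1)) := hV1.differentiable one_ne_zero
  have hpol1 : ∀ y : EuclideanSpace ℝ (Fin 3), curl (v (-1)) y 2 = 0 := fun y =>
    curl_apply_two_eq_zero_of_inner (hpol (-1) hs y)
  have hshear : ∀ z μ : ℝ, (∀ y : EuclideanSpace ℝ (Fin 3), y 2 = z → ∀ b : Fin 3, b ≠ 2 →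
      fderiv ℝ (v (-1)) y (EuclideanSpace.single 2 1) b = μ * fderiv ℝ (v (-1)) y (EuclideanSpace.single b 1) 2) →
      ∀ y : EuclideanSpace ℝ (Fin 3), y 2 = z → curl (v (-1)) y = 0 := fun z μ hμ y hy =>
    curl_eq_zero_on_plane_of_weightOsc_zero hVd hμ (fun y' hy' => hpol1 y') (hosc z μ hμ) hy
  have hNF := timeHeightShear_normalForm hrate hcont hmild hW hWne hWs hTH (-1) hs
  by_cases hall : ∀ cc : ℝ, ∀ y : EuclideanSpace ℝ (Fin 3), y 2 = cc →
      fderiv ℝ (v (-1)) y (EuclideanSpace.single 0 1) 2 = 0 ∧ fderiv ℝ (v (-1)) y (EuclideanSpace.single 1 1) 2 = 0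
  · exact eq_zero_of_flatPlanes_open hrate hcont hmild hdiv hpol hs isOpen_univ univ_nonempty fun cc _ y hy => hall cc y hy
  · push Not at hall
    obtain ⟨c₀, y₀, hy₀, hne⟩ := hall
    have hne' : ∃ b : Fin 3, b ≠ 2 ∧ fderiv ℝ (v (-1)) y₀ (EuclideanSpace.single b 1) 2 ≠ 0 := by
      by_cases h0 : fderiv ℝ (v (-1)) y₀ (EuclideanSpace.single 0 1) 2 = 0
      · exact ⟨1, by decide, hne h0⟩
      · exact ⟨0, by decide, h0⟩
    obtain ⟨b, hb, hneb⟩ := hne'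
    have hev := nonflat_nhds hV1 (b := b) hneb
    rw [hy₀] at hev
    obtain ⟨ε, hε, hball⟩ := Metric.eventually_nhds_iff.1 hev
    have hcurl : ∀ y ∈ {y : EuclideanSpace ℝ (Fin 3) | y 2 ∈ Metric.ball c₀ ε}, curl (v (-1)) y = 0 := by
      intro y hy
      obtain ⟨y₁, hy₁, hne₁⟩ := hball hy
      rcases hNF (y 2) with hflat | ⟨μ, hμ⟩
      · exact absurd ((fun h => by fin_cases b <;> simp_all) (hflat y₁ hy₁)) (by simpa using hne₁)
      · exact hshear (y 2) μ hμ y rfl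
    have hU : IsOpen {y : EuclideanSpace ℝ (Fin 3) | y 2 ∈ Metric.ball c₀ ε} :=
      Metric.isOpen_ball.preimage (EuclideanSpace.proj (𝕜 := ℝ) (2 : Fin 3)).continuous
    have hUne : ({y : EuclideanSpace ℝ (Fin 3) | y 2 ∈ Metric.ball c₀ ε}).Nonempty := ⟨y₀, by simpa [hy₀] using hε⟩
    exact eq_zero_of_curl_eq_zero_on_open hrate hcont hmild hdiv hs hU hUne hcurl

/-- **CLASS + POLOIDAL + (TH) WINDOW + THE PHYSICAL-VARIABLE OBJECT ⇒ `v ≡ 0`.**  The object (t < 0 throughout): functions `O, S : ℝ → ℝ → ℝ` of `(t,z)` and the joint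
derivative `Od t z : ℝ × ℝ →L[ℝ] ℝ` of `uncurry O`, with port-2's INPUT list of `simObject_of_planeObject` VERBATIM — regularity, (OSC) `∂ₜO + ½∂_z(S·O) − ∂_zzO ≤ 0`
pointwise, `0 ≤ O`, the Type-I dictionary `√(−t)·O ≤ c`, `√(−t)|S| ≤ A`, scale-invariant polynomial bounds on `∂ₜO, ∂_zO, ∂_zzO, ∂_zS` — plus the PLANE MAJORANT:
on every proportional-shear plane `{y₂ = z}` (slope `μ`) of every slice `t < 0`, `|(1−μ)(v₂(t,y) − v₂(t,y′))| ≤ O(t,z)`. -/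
theorem eq_zero_of_planeOscObject {C : ℝ} {v : ℝ → EuclideanSpace ℝ (Fin 3) → EuclideanSpace ℝ (Fin 3)}
    (hrate : HasTypeITimeDecay C v) (hcont : ContinuousOn (uncurry v) (Iio (0 : ℝ) ×ˢ univ))
    (hmild : ∀ s t : ℝ, s < t → t < 0 → ∀ x,
      v t x = UnboundedOperators.heatExtension (v s) (t - s) x - oseenDuhamel 1 s v v t x)
    (hdiv : ∀ t < 0, VectorCalculus.IsDivFree (v t))
    (hpol : ∀ s < 0, ∀ y, ⟪curl (v s) y, EuclideanSpace.single 2 1⟫_ℝ = 0)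
    {W : Set (ℝ × EuclideanSpace ℝ (Fin 3))} (hW : IsOpen W) (hWne : W.Nonempty) (hWs : W ⊆ Iio (0 : ℝ) ×ˢ univ)
    {m : ℝ → ℝ → ℝ}
    (hTH : ∀ z ∈ W, ∀ b : Fin 3, b ≠ 2 →
      fderiv ℝ (v z.1) z.2 (EuclideanSpace.single 2 1) b = m z.1 (z.2 2) * fderiv ℝ (v z.1) z.2 (EuclideanSpace.single b 1) 2)
    (hObj : ∃ (O S : ℝ → ℝ → ℝ) (Od : ℝ → ℝ → (ℝ × ℝ →L[ℝ] ℝ)) (c A K : ℝ) (k : ℕ),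
      (∀ t < 0, ∀ z, HasFDerivAt (Function.uncurry O) (Od t z) (t, z)) ∧
      (∀ t < 0, Continuous fun z => Od t z (1, 0)) ∧
      (∀ t < 0, ContDiff ℝ 2 (O t)) ∧ (∀ t < 0, ContDiff ℝ 1 (S t)) ∧
      (∀ t < 0, ∀ z, Od t z (1, 0) + (1 / 2 : ℝ) * deriv (fun z => S t z * O t z) z - deriv (deriv (O t)) z ≤ 0) ∧
      (∀ t < 0, ∀ z, 0 ≤ O t z) ∧ (∀ t < 0, ∀ z, Real.sqrt (-t) * O t z ≤ c) ∧
      (∀ t < 0, ∀ z, Real.sqrt (-t) * |S t z| ≤ A) ∧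
      (∀ t < 0, ∀ z, Real.sqrt (-t) * (-t) * |Od t z (1, 0)| ≤ K * (1 + z ^ 2 / (-t)) ^ k) ∧
      (∀ t < 0, ∀ z, (-t) * |deriv (O t) z| ≤ K * (1 + z ^ 2 / (-t)) ^ k) ∧
      (∀ t < 0, ∀ z, Real.sqrt (-t) * (-t) * |deriv (deriv (O t)) z| ≤ K * (1 + z ^ 2 / (-t)) ^ k) ∧
      (∀ t < 0, ∀ z, (-t) * |deriv (S t) z| ≤ K * (1 + z ^ 2 / (-t)) ^ k) ∧
      (∀ t : ℝ, t < 0 → ∀ z μ : ℝ,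
        (∀ y : EuclideanSpace ℝ (Fin 3), y 2 = z → ∀ b : Fin 3, b ≠ 2 →
          fderiv ℝ (v t) y (EuclideanSpace.single 2 1) b = μ * fderiv ℝ (v t) y (EuclideanSpace.single b 1) 2) →
        ∀ y y' : EuclideanSpace ℝ (Fin 3), y 2 = z → y' 2 = z → |(1 - μ) * (v t y 2 - v t y' 2)| ≤ O t z)) :
    ∀ t < 0, ∀ x, v t x = 0 := by
  obtain ⟨O, S, Od, c, A, K, k, hOF, hOtc, hO2, hS1, hosc, h0, hc, hSA, hOt, hOz, hOzz, hSz, hmaj⟩ := hObj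
  -- the similarity object (port-2) and the ancient Liouville theorem for every compression
  obtain ⟨Qt, hQ2, hQt, hQtc, hQ0', hQc, hQtb, hQ1b, hQ2b, hSS, hSSA, hSS1, hsub⟩ :=
    simObject_of_planeObject hOF hOtc hO2 hS1 hosc h0 hc hSA hOt hOz hOzz hSz
  have hSSA' : ∀ τ ξ, |simQ S τ ξ| ≤ max A 1 := fun τ ξ => (hSSA τ ξ).trans (le_max_left A 1)
  have hQ0 : ∀ τ ξ, simQ O τ ξ = 0 :=
    eq_zero_of_ancient_oscSubsolution_anyK (lt_of_lt_of_le one_pos (le_max_right A 1)) hQ2 hQt hQtc hQ0' hQc hQtb hQ1b hQ2b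
      hSS hSSA' hSS1 hsub
  -- back to physical variables: `O ≡ 0` on the slab
  have hO0 : ∀ t < 0, ∀ z, O t z = 0 := by
    intro t ht z
    obtain ⟨τ, ξ, hτ, hξ⟩ := exists_sim_preimage ht z
    have h := hQ0 τ ξ
    unfold simQ at h
    rw [hτ, hξ] at h
    rcases mul_eq_zero.1 h with h1 | h1
    · exact absurd h1 (sig_pos τ).ne'
    · exact h1
  -- the weight oscillation vanishes on proportional-shear planes of the slice `−1`
  refine eq_zero_of_weightOsc_zero hrate hcont hmild hdiv hpol hW hWne hWs hTH fun z μ hμ y y' hy hy' => ?_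
  have h := hmaj (-1) (by norm_num) z μ hμ y y' hy hy'
  rw [hO0 (-1) (by norm_num) z] at h
  exact abs_eq_zero.1 (le_antisymm h (abs_nonneg _))

/-- **THE CLASS ROAD TO `stub_twistingTHGerm` BY NAME, PHYSICAL CURRENCY.**  If every poloidal class profile normalised at the hot spot and carrying a (TH) window admits the
(t,z)-object of `eq_zero_of_planeOscObject`, then the registered signature of `stub_twistingTHGerm` (skeleton `Cruxes/LrcModEntire/Lines/twist_split.lean` v6) holds. -/
theorem twistingTHGerm_of_planeOscObject
    (hH : ∀ (C : ℝ) (v : ℝ → EuclideanSpace ℝ (Fin 3) → EuclideanSpace ℝ (Fin 3)),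
      Literature.Analysis.FluidPDE.HasTypeITimeDecay C v →
      ContinuousOn (Function.uncurry v) (Set.Iio (0 : ℝ) ×ˢ Set.univ) →
      (∀ s t : ℝ, s < t → t < 0 → ∀ x, v t x =
        Literature.Analysis.UnboundedOperators.heatExtension (v s) (t - s) x -
          Literature.Analysis.FluidPDE.oseenDuhamel 1 s v v t x) →
      (∀ t < 0, Literature.Analysis.FluidPDE.VectorCalculus.IsDivFree (v t)) →
      (∀ s < 0, ∀ y, ⟪Literature.Analysis.FluidPDE.curl (v s) y, EuclideanSpace.single 2 1⟫_ℝ = 0) →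
      v (-1) 0 2 ≠ 0 → (∀ t < 0, ∀ x, Real.sqrt (-t) * |v t x 2| ≤ |v (-1) 0 2|) →
      ∀ W : Set (ℝ × EuclideanSpace ℝ (Fin 3)), IsOpen W → W.Nonempty → W ⊆ Set.Iio (0 : ℝ) ×ˢ Set.univ →
        (∃ m : ℝ → ℝ → ℝ, ∀ z ∈ W, ∀ b : Fin 3, b ≠ 2 →
            fderiv ℝ (v z.1) z.2 (EuclideanSpace.single 2 1) b =
              m z.1 (z.2 2) * fderiv ℝ (v z.1) z.2 (EuclideanSpace.single b 1) 2) →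
        ∃ (O S : ℝ → ℝ → ℝ) (Od : ℝ → ℝ → (ℝ × ℝ →L[ℝ] ℝ)) (c A K : ℝ) (k : ℕ),
          (∀ t < 0, ∀ z, HasFDerivAt (Function.uncurry O) (Od t z) (t, z)) ∧
          (∀ t < 0, Continuous fun z => Od t z (1, 0)) ∧
          (∀ t < 0, ContDiff ℝ 2 (O t)) ∧ (∀ t < 0, ContDiff ℝ 1 (S t)) ∧
          (∀ t < 0, ∀ z, Od t z (1, 0) + (1 / 2 : ℝ) * deriv (fun z => S t z * O t z) z - deriv (deriv (O t)) z ≤ 0) ∧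
          (∀ t < 0, ∀ z, 0 ≤ O t z) ∧ (∀ t < 0, ∀ z, Real.sqrt (-t) * O t z ≤ c) ∧
          (∀ t < 0, ∀ z, Real.sqrt (-t) * |S t z| ≤ A) ∧
          (∀ t < 0, ∀ z, Real.sqrt (-t) * (-t) * |Od t z (1, 0)| ≤ K * (1 + z ^ 2 / (-t)) ^ k) ∧
          (∀ t < 0, ∀ z, (-t) * |deriv (O t) z| ≤ K * (1 + z ^ 2 / (-t)) ^ k) ∧
          (∀ t < 0, ∀ z, Real.sqrt (-t) * (-t) * |deriv (deriv (O t)) z| ≤ K * (1 + z ^ 2 / (-t)) ^ k) ∧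
          (∀ t < 0, ∀ z, (-t) * |deriv (S t) z| ≤ K * (1 + z ^ 2 / (-t)) ^ k) ∧
          (∀ t : ℝ, t < 0 → ∀ z μ : ℝ,
            (∀ y : EuclideanSpace ℝ (Fin 3), y 2 = z → ∀ b : Fin 3, b ≠ 2 →
              fderiv ℝ (v t) y (EuclideanSpace.single 2 1) b = μ * fderiv ℝ (v t) y (EuclideanSpace.single b 1) 2) →
            ∀ y y' : EuclideanSpace ℝ (Fin 3), y 2 = z → y' 2 = z → |(1 - μ) * (v t y 2 - v t y' 2)| ≤ O t z)) :
    ∀ (C : ℝ) (v : ℝ → EuclideanSpace ℝ (Fin 3) → EuclideanSpace ℝ (Fin 3)),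
      Literature.Analysis.FluidPDE.HasTypeITimeDecay C v →
      ContinuousOn (Function.uncurry v) (Set.Iio (0 : ℝ) ×ˢ Set.univ) →
      (∀ s t : ℝ, s < t → t < 0 → ∀ x, v t x =
        Literature.Analysis.UnboundedOperators.heatExtension (v s) (t - s) x -
          Literature.Analysis.FluidPDE.oseenDuhamel 1 s v v t x) →
      (∀ t < 0, Literature.Analysis.FluidPDE.VectorCalculus.IsDivFree (v t)) →
      (∀ s < 0, ∀ y, ⟪Literature.Analysis.FluidPDE.curl (v s) y, EuclideanSpace.single 2 1⟫_ℝ = 0) →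
      v (-1) 0 2 ≠ 0 → (∀ t < 0, ∀ x, Real.sqrt (-t) * |v t x 2| ≤ |v (-1) 0 2|) →
      (∀ h : EuclideanSpace ℝ (Fin 3), fderiv ℝ (v (-1)) 0 h 2 = 0) →
      (deriv (fun s => v s 0 2) (-1) = v (-1) 0 2 / 2 ∧ v (-1) 0 2 * (Δ (fun y => v (-1) y 2)) 0 ≤ 0) →
      ∀ W : Set (ℝ × EuclideanSpace ℝ (Fin 3)), IsOpen W → W.Nonempty → W ⊆ Set.Iio (0 : ℝ) ×ˢ Set.univ →
        (∀ z ∈ W, (Literature.Analysis.FluidPDE.curl (v z.1) z.2 ≠ 0 ∧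
            (fderiv ℝ (v z.1) z.2 (EuclideanSpace.single 0 1) 2 ≠ 0 ∨ fderiv ℝ (v z.1) z.2 (EuclideanSpace.single 1 1) 2 ≠ 0) ∧
            (fderiv ℝ (v z.1) z.2 (EuclideanSpace.single 2 1) 0 ≠ 0 ∨ fderiv ℝ (v z.1) z.2 (EuclideanSpace.single 2 1) 1 ≠ 0))) →
        (∀ m : ℝ → ℝ, ∀ W₁ : Set (ℝ × EuclideanSpace ℝ (Fin 3)), W₁ ⊆ W → IsOpen W₁ → W₁.Nonempty →
            ∃ z ∈ W₁, ∃ b : Fin 3, b ≠ 2 ∧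
              fderiv ℝ (v z.1) z.2 (EuclideanSpace.single 2 1) b ≠
                m z.1 * fderiv ℝ (v z.1) z.2 (EuclideanSpace.single b 1) 2) →
        (∀ z ∈ W, (fderiv ℝ (fun x => fderiv ℝ (v z.1) x (EuclideanSpace.single 2 1) 2) z.2 (EuclideanSpace.single 0 1) *
                fderiv ℝ (v z.1) z.2 (EuclideanSpace.single 1 1) 2 -
              fderiv ℝ (fun x => fderiv ℝ (v z.1) x (EuclideanSpace.single 2 1) 2) z.2 (EuclideanSpace.single 1 1) *
                fderiv ℝ (v z.1) z.2 (EuclideanSpace.single 0 1) 2 ≠ 0)) →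
        (∃ m : ℝ → ℝ → ℝ, ∀ z ∈ W, ∀ b : Fin 3, b ≠ 2 →
            fderiv ℝ (v z.1) z.2 (EuclideanSpace.single 2 1) b =
              m z.1 (z.2 2) * fderiv ℝ (v z.1) z.2 (EuclideanSpace.single b 1) 2) →
        ∃ s : ℝ, s < 0 ∧ ∃ U : Set (EuclideanSpace ℝ (Fin 3)), IsOpen U ∧ U.Nonempty ∧
          ((∃ e : EuclideanSpace ℝ (Fin 3), e ≠ 0 ∧
              ∀ y ∈ U, fderiv ℝ (Literature.Analysis.FluidPDE.curl (v s)) y e = 0) ∨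
           (∃ c : EuclideanSpace ℝ (Fin 3), ∀ y ∈ U,
              Literature.Analysis.FluidPDE.rotGen (Literature.Analysis.FluidPDE.curl (v s) y) =
                fderiv ℝ (Literature.Analysis.FluidPDE.curl (v s)) y (Literature.Analysis.FluidPDE.rotGen (y - c))) ∨
           (∃ w : EuclideanSpace ℝ (Fin 3) → EuclideanSpace ℝ (Fin 3), AnalyticOnNhd ℝ w Set.univ ∧
              ¬ BddAbove (Set.range fun y => ‖w y‖) ∧ ∀ y ∈ U, v s y = w y)) := by
  intro C v hrate hcont hmild hdiv hpol hne hhot _hthread _hpins W hW hWne hWs _hnd _hpin _htw hTH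
  obtain ⟨m, hm⟩ := hTH
  have hzero := eq_zero_of_planeOscObject hrate hcont hmild hdiv hpol hW hWne hWs hm
    (hH C v hrate hcont hmild hdiv hpol hne hhot W hW hWne hWs ⟨m, hm⟩)
  have h0 : v (-1) 0 = 0 := hzero (-1) (by norm_num) 0
  exact absurd (by rw [h0]; rfl) hne

end Summit.NavierStokesRegularity.NavierStokesRegularity.Theorems.PoloidalWindowDoorLrcModEntireTwistingTHOscRoadPlane
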